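import Literature.AlgebraicGeometry.Motives.MixedHodgeStructureSplitOverQFunctorial
import Literature.AlgebraicGeometry.Motives.MixedHodgeStructureDualSubobjects
import Literature.AlgebraicGeometry.Motives.MixedHodgeStructureBidual
import HarnessLib

/-!
# `ℚ`-split mixed Hodge structures: Tate twists and duals

Green–Griffiths–Kerr, *Mumford–Tate groups and domains*, Prop. (I.C.2) (ii): the Deligne bigrading
`V^{•,•}` "is compatible with tensor products, duals and Hom"; §I.C (I.C.7)–(I.C.8), footnote 3 (`ℚ`-split
MHS). Cattani–El Zein–Griffiths–Lê, Ex. 3.1.5 / Ex. 3.2.23 (4): `H(m)^{p,q} = H^{p+m,q+m}`,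
`W_r H(m) = W_{r+2m} H`; §3.2.2.7 (dual MHS). Fujiki 1980 (1.6.2) a)–b): `W'_i = (W_{-i-1})^⊥`, annihilators of
sub-MHS are sub-MHS (the tree's `SubMixedHodgeStructure.annihilator`). Carlson 1980 §2(b) Prop. 2 (weight
classes / complements; the tree's characterisation `isSplitOverQ_iff_forall_exists_isCompl`).

* §1 **Tate twists**: `E_n(H(j)) = E_{n+2j}(H)` (`deligneE_tateTwist`); `H(j)` is `ℚ`-split iff `H` is
  (`IsSplitOverQ.tateTwist`, `isSplitOverQ_tateTwist_iff`).
* §2 **Duals**: complements dualise — if `W_{-m-1} H ⊕ T = H` with `T` a sub-MHS then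
  `W_m(H^∨) ⊕ T^⊥ = H^∨` (`isCompl_dual_W_annihilator`); hence `H^∨` is `ℚ`-split iff `H` is
  (`IsSplitOverQ.dual`, `isSplitOverQ_dual_iff`, via the bidual isomorphism).

All statements proved; no definitions, no named facts.

## References

* [GreenGriffithsKerr2012] M. Green, P. Griffiths, M. Kerr, Mumford–Tate groups and domains (2012),
  Prop. (I.C.2) (ii), §I.C (I.C.7)–(I.C.8), footnote 3.
* [CattaniElZeinGriffithsLe2014] E. Cattani et al. (eds.), Hodge Theory (2014), Ex. 3.1.5, Ex. 3.2.23 (4), §3.2.2.7.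
* [Fujiki1980] A. Fujiki, Duality of mixed Hodge structures of algebraic varieties, Publ. RIMS 16 (1980), (1.6.2).
* [Carlson1980] J. A. Carlson, Extensions of mixed Hodge structures (1980), §2(b) Prop. 2.
-/

noncomputable section

open scoped TensorProduct

namespace Literature.AlgebraicGeometry.Motives

namespace MixedHodgeStructure

universe u

variable {V : Type u} [AddCommGroup V] [Module ℚ V]

/-! ### §1 Tate twists -/

/-- **`E_n(H(j)) = E_{n+2j}(H)`**: twisting by `j` shifts the eigenspaces of the Deligne grading by `2j`
(`I^{p,q}(H(j)) = I^{p+j,q+j}(H)`). [cite: CattaniElZeinGriffithsLe2014, Ex. 3.1.5 and Ex. 3.2.23 (4)] -/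
theorem deligneE_tateTwist (H : MixedHodgeStructure V) (j n : ℤ) :
    (H.tateTwist j).deligneE n = H.deligneE (n + 2 * j) := by
  refine le_antisymm (iSup₂_le fun pq hpq => ?_) (iSup₂_le fun pq hpq => ?_)
  · rw [show (H.tateTwist j).deligneFamily pq = (H.tateTwist j).deligneI pq.1 pq.2 from rfl, H.deligneI_tateTwist]
    exact H.deligneI_le_deligneE (by omega)
  · rw [show H.deligneFamily pq = H.deligneI pq.1 pq.2 from rfl,
      show H.deligneI pq.1 pq.2 = (H.tateTwist j).deligneI (pq.1 - j) (pq.2 - j) by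
        rw [H.deligneI_tateTwist, sub_add_cancel, sub_add_cancel]]
    exact (H.tateTwist j).deligneI_le_deligneE (by omega)

/-- **Tate twists of `ℚ`-split MHS are `ℚ`-split** (`U_n(H(j)) = U_{n+2j}(H)`). [cite: GreenGriffithsKerr2012, §I.C (I.C.7)–(I.C.8)] -/
theorem IsSplitOverQ.tateTwist {H : MixedHodgeStructure V} (h : H.IsSplitOverQ) (j : ℤ) : (H.tateTwist j).IsSplitOverQ := by
  intro n
  obtain ⟨U, hU⟩ := h (n + 2 * j)
  exact ⟨U, by rw [hU, deligneE_tateTwist]⟩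

/-- `H(j)` is `ℚ`-split iff `H` is. [cite: GreenGriffithsKerr2012, §I.C (I.C.7)–(I.C.8)] -/
theorem isSplitOverQ_tateTwist_iff (H : MixedHodgeStructure V) (j : ℤ) : (H.tateTwist j).IsSplitOverQ ↔ H.IsSplitOverQ := by
  refine ⟨fun h => ?_, fun h => h.tateTwist j⟩
  have h' := h.tateTwist (-j)
  rwa [tateTwist_tateTwist, add_neg_cancel, tateTwist_zero] at h'

/-! ### §2 Duals -/

variable [FiniteDimensional ℚ V] {H : MixedHodgeStructure V}

/-- **Complements dualise**: if `W_{-m-1} H ⊕ T = H` for a sub-MHS `T`, then `W_m(H^∨) ⊕ T^⊥ = H^∨`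
(`W_m(H^∨) = (W_{-m-1} H)^⊥`, and `U ↦ U^⊥` exchanges `∩` and `+`). [cite: Fujiki1980, (1.6.2) a)–b)] -/
theorem isCompl_dual_W_annihilator {m : ℤ} {T : SubMixedHodgeStructure H} (hT : IsCompl (H.W (-m - 1)) T.toSubmodule) :
    IsCompl (H.dual.W m) T.annihilator.toSubmodule := by
  rw [dual_W, SubMixedHodgeStructure.annihilator_toSubmodule]
  refine IsCompl.of_eq ?_ ?_
  · rw [← Submodule.dualAnnihilator_sup_eq, hT.sup_eq_top, Submodule.dualAnnihilator_top]
  · rw [← Subspace.dualAnnihilator_inf_eq, hT.inf_eq_bot, Submodule.dualAnnihilator_bot]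

/-- **The dual of a `ℚ`-split MHS is `ℚ`-split.** [cite: GreenGriffithsKerr2012, Prop. (I.C.2) (ii)] -/
theorem IsSplitOverQ.dual (h : H.IsSplitOverQ) : H.dual.IsSplitOverQ :=
  isSplitOverQ_of_forall_exists_isCompl fun m => by
    obtain ⟨T, hT⟩ := h.exists_isCompl_W (-m - 1)
    exact ⟨T.annihilator, isCompl_dual_W_annihilator hT⟩

/-- **`H^∨` is `ℚ`-split iff `H` is** (bidual `H ≅ H^∨∨`). [cite: GreenGriffithsKerr2012, Prop. (I.C.2) (ii)] -/
theorem isSplitOverQ_dual_iff : H.dual.IsSplitOverQ ↔ H.IsSplitOverQ :=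
  ⟨fun h => (isSplitOverQ_iff_of_bijective (Hom.bidual H) (Hom.bidual_bijective H)).2 h.dual, fun h => h.dual⟩

/-- The annihilator of a weight piece complement computes the dual complement explicitly: for a `ℚ`-split
`H`, `W_m(H^∨)` has the complementary sub-MHS `T^⊥` where `T` is the canonical complement of `W_{-m-1} H`.
[cite: Fujiki1980, (1.6.2) b)] -/
theorem IsSplitOverQ.exists_isCompl_dual_W (h : H.IsSplitOverQ) (m : ℤ) :
    ∃ T : SubMixedHodgeStructure H, IsCompl (H.W (-m - 1)) T.toSubmodule ∧ IsCompl (H.dual.W m) T.annihilator.toSubmodule := by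
  obtain ⟨T, hT⟩ := h.exists_isCompl_W (-m - 1)
  exact ⟨T, hT, isCompl_dual_W_annihilator hT⟩

end MixedHodgeStructure

end Literature.AlgebraicGeometry.Motives
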